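import Summits.QuantumFields.YangMills.Theorems.F4SubCurvatureDoorTransverseSliceGeometry
import Mathlib
import HarnessLib

/-!
# OddModeRigidity / R-O1 «ANALYTIC HALF» — helper: the orthonormal frame of `Π₀ ⊕ Π₀^⊥` and the plane rotations as isometries of `ℝ⁴`

Crux ⟨stmt-QuantumFields-23035⟩ `F4SubCurvatureDoor.ShortRootRigidity`, stub `:146 stub_oddModeRigidity`, typed split
`Cruxes/ShortRootRigidity/Lines/odd_mode_split.lean` (ym-idea-3 g21), piece `AnalyticHalf`.  Helper toward it.

The vocabulary of ✓`…SliceDensityRegistered`: `planeEmb y = y₀ e₀ + y₁ m`, `perpEmb x = x₀ b₁ + x₁ b₂` with the orthonormal frame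
`e₀ = (1,0,0,0)`, `m = (0,1,1,1)/√3`, `b₁ = (0,1,−1,0)/√2`, `b₂ = (0,1,1,−2)/√6` of `ℝ⁴ = Π₀ ⊕ Π₀^⊥`.  Proved here (proof lane, no definitions):
* `norm_sq_planeEmb_add_perpEmb` — `‖planeEmb y + perpEmb x‖² = ‖y‖² + ‖x‖²` (cf. the inequalities of ✓`…TransverseSliceGeometry`);
* `exists_planeEmb_add_perpEmb` — every `w ∈ ℝ⁴` is `planeEmb y + perpEmb x`;
* `exists_planeRotation` — for every isometry `R` of `ℝ²` there is a linear isometry `T` of `ℝ⁴` with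
  `T (planeEmb y + perpEmb x) = planeEmb (R y) + perpEmb x` (`T = R ⊕ id`);
* `evenPartSliceInvariant_pointwise` — `EvenPartSliceInvariant K` is the POINTWISE linear identity
  `K∘T_R + K∘T_{−R} = K + K∘T_{−1}` on all of `ℝ⁴` for such isometries.

Mathlib + tree only; no `sorry`.  HONEST LABEL: helper for one piece (`AnalyticHalf`) of the OPEN stub `:146`; `OddModeRigidity`, ⟨23035⟩,
⟨23125⟩, R2d and the Yang–Mills mass gap remain OPEN; no summit is proved by a line.  Seat `ym-line-frs-p2` g16 (cell ym-idea-3, free hands).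
-/

noncomputable section

open scoped BigOperators RealInnerProductSpace

namespace Summit.QuantumFields.YangMills.Theorems.F4SubCurvatureDoorAnalyticHalfProof

open Summit.QuantumFields.YangMills.Theorems.F4SubCurvatureDoorMirrorAnalyticityRegistered (E4)
open Summit.QuantumFields.YangMills.Theorems.F4SubCurvatureDoorSliceDensityRegistered (E2 planeEmb perpEmb EvenPartSliceInvariant)
open Summit.QuantumFields.YangMills.Theorems.F4SubCurvatureDoorSliceInClass (planeEmb_neg)

/-! ## Coordinates -/

/-- Coordinates of `planeEmb y`. -/
theorem planeEmb_apply (y : E2) (i : Fin 4) :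
    planeEmb y i = ![y 0, y 1 / Real.sqrt 3, y 1 / Real.sqrt 3, y 1 / Real.sqrt 3] i := rfl

/-- Coordinates of `perpEmb x`. -/
theorem perpEmb_apply (x : E2) (i : Fin 4) :
    perpEmb x i = ![0, x 0 / Real.sqrt 2 + x 1 / Real.sqrt 6, -(x 0 / Real.sqrt 2) + x 1 / Real.sqrt 6, -(2 * x 1 / Real.sqrt 6)] i := rfl

/-- `planeEmb` is additive. -/
theorem planeEmb_add (y y' : E2) : planeEmb (y + y') = planeEmb y + planeEmb y' := by
  ext i
  fin_cases i <;> simp [planeEmb_apply] <;> ring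

/-- `planeEmb` is homogeneous. -/
theorem planeEmb_smul (c : ℝ) (y : E2) : planeEmb (c • y) = c • planeEmb y := by
  ext i
  fin_cases i <;> simp [planeEmb_apply] <;> ring

/-- `perpEmb` is additive. -/
theorem perpEmb_add (x x' : E2) : perpEmb (x + x') = perpEmb x + perpEmb x' := by
  ext i
  fin_cases i <;> simp [perpEmb_apply] <;> ring

/-- `perpEmb` is homogeneous. -/
theorem perpEmb_smul (c : ℝ) (x : E2) : perpEmb (c • x) = c • perpEmb x := by
  ext i
  fin_cases i <;> simp [perpEmb_apply] <;> ring

/-- **The frame is orthonormal**: `‖planeEmb y + perpEmb x‖² = ‖y‖² + ‖x‖²`. -/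
theorem norm_sq_planeEmb_add_perpEmb (y x : E2) : ‖planeEmb y + perpEmb x‖ ^ 2 = ‖y‖ ^ 2 + ‖x‖ ^ 2 := by
  have inv_sqrt_two_sq : (Real.sqrt 2)⁻¹ ^ 2 = (2 : ℝ)⁻¹ := by rw [inv_pow, Real.sq_sqrt (by norm_num)]
  have inv_sqrt_three_sq : (Real.sqrt 3)⁻¹ ^ 2 = (3 : ℝ)⁻¹ := by rw [inv_pow, Real.sq_sqrt (by norm_num)]
  have inv_sqrt_six_sq : (Real.sqrt 6)⁻¹ ^ 2 = (6 : ℝ)⁻¹ := by rw [inv_pow, Real.sq_sqrt (by norm_num)]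
  rw [EuclideanSpace.norm_sq_eq, EuclideanSpace.norm_sq_eq, EuclideanSpace.norm_sq_eq]
  simp only [Fin.sum_univ_four, Fin.sum_univ_two, Real.norm_eq_abs, sq_abs, PiLp.add_apply, planeEmb_apply, perpEmb_apply,
    Matrix.cons_val_zero, Matrix.cons_val_one, Matrix.head_cons, Matrix.cons_val_two, Matrix.tail_cons, Matrix.cons_val_three,
    div_eq_mul_inv]
  linear_combination (3 * (y 1) ^ 2) * inv_sqrt_three_sq + (2 * (x 0) ^ 2) * inv_sqrt_two_sq + (6 * (x 1) ^ 2) * inv_sqrt_six_sq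

/-- **Reconstruction**: `w = planeEmb (w₀, (w₁+w₂+w₃)/√3) + perpEmb ((w₁−w₂)/√2, (w₁+w₂−2w₃)/√6)`. -/
theorem planeEmb_add_perpEmb_coords (w : E4) :
    planeEmb ((WithLp.equiv 2 (Fin 2 → ℝ)).symm ![w 0, (w 1 + w 2 + w 3) / Real.sqrt 3]) +
      perpEmb ((WithLp.equiv 2 (Fin 2 → ℝ)).symm ![(w 1 - w 2) / Real.sqrt 2, (w 1 + w 2 - 2 * w 3) / Real.sqrt 6]) = w := by
  have inv_sqrt_two_sq : (Real.sqrt 2)⁻¹ ^ 2 = (2 : ℝ)⁻¹ := by rw [inv_pow, Real.sq_sqrt (by norm_num)]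
  have inv_sqrt_three_sq : (Real.sqrt 3)⁻¹ ^ 2 = (3 : ℝ)⁻¹ := by rw [inv_pow, Real.sq_sqrt (by norm_num)]
  have inv_sqrt_six_sq : (Real.sqrt 6)⁻¹ ^ 2 = (6 : ℝ)⁻¹ := by rw [inv_pow, Real.sq_sqrt (by norm_num)]
  symm
  ext i
  fin_cases i
  · simp [PiLp.add_apply, planeEmb_apply, perpEmb_apply]
  · simp [PiLp.add_apply, planeEmb_apply, perpEmb_apply, div_eq_mul_inv]
    linear_combination (-(w 1 + w 2 + w 3)) * inv_sqrt_three_sq + (-(w 1 - w 2)) * inv_sqrt_two_sq +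
      (-(w 1 + w 2 - 2 * w 3)) * inv_sqrt_six_sq
  · simp [PiLp.add_apply, planeEmb_apply, perpEmb_apply, div_eq_mul_inv]
    linear_combination (-(w 1 + w 2 + w 3)) * inv_sqrt_three_sq + (w 1 - w 2) * inv_sqrt_two_sq +
      (-(w 1 + w 2 - 2 * w 3)) * inv_sqrt_six_sq
  · simp [PiLp.add_apply, planeEmb_apply, perpEmb_apply, div_eq_mul_inv]
    linear_combination (-(w 1 + w 2 + w 3)) * inv_sqrt_three_sq + (2 * (w 1 + w 2 - 2 * w 3)) * inv_sqrt_six_sq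

/-- The `Π₀`-coordinates of `planeEmb y + perpEmb x` are `y`. -/
theorem planeCoords_emb (y x : E2) :
    (WithLp.equiv 2 (Fin 2 → ℝ)).symm ![(planeEmb y + perpEmb x) 0,
      ((planeEmb y + perpEmb x) 1 + (planeEmb y + perpEmb x) 2 + (planeEmb y + perpEmb x) 3) / Real.sqrt 3] = y := by
  have inv_sqrt_three_sq : (Real.sqrt 3)⁻¹ ^ 2 = (3 : ℝ)⁻¹ := by rw [inv_pow, Real.sq_sqrt (by norm_num)]
  ext i
  fin_cases i
  · simp [PiLp.add_apply, planeEmb_apply, perpEmb_apply]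
  · simp [PiLp.add_apply, planeEmb_apply, perpEmb_apply, div_eq_mul_inv]
    linear_combination (3 * y 1) * inv_sqrt_three_sq

/-- The `Π₀^⊥`-coordinates of `planeEmb y + perpEmb x` are `x`. -/
theorem perpCoords_emb (y x : E2) :
    (WithLp.equiv 2 (Fin 2 → ℝ)).symm ![((planeEmb y + perpEmb x) 1 - (planeEmb y + perpEmb x) 2) / Real.sqrt 2,
      ((planeEmb y + perpEmb x) 1 + (planeEmb y + perpEmb x) 2 - 2 * (planeEmb y + perpEmb x) 3) / Real.sqrt 6] = x := by
  have inv_sqrt_two_sq : (Real.sqrt 2)⁻¹ ^ 2 = (2 : ℝ)⁻¹ := by rw [inv_pow, Real.sq_sqrt (by norm_num)]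
  have inv_sqrt_six_sq : (Real.sqrt 6)⁻¹ ^ 2 = (6 : ℝ)⁻¹ := by rw [inv_pow, Real.sq_sqrt (by norm_num)]
  ext i
  fin_cases i
  · simp [PiLp.add_apply, planeEmb_apply, perpEmb_apply, div_eq_mul_inv]
    linear_combination (2 * x 0) * inv_sqrt_two_sq
  · simp [PiLp.add_apply, planeEmb_apply, perpEmb_apply, div_eq_mul_inv]
    linear_combination (6 * x 1) * inv_sqrt_six_sq

/-- **The frame spans**: every `w ∈ ℝ⁴` is `planeEmb y + perpEmb x`. -/
theorem exists_planeEmb_add_perpEmb (w : E4) : ∃ y x : E2, w = planeEmb y + perpEmb x :=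
  ⟨_, _, (planeEmb_add_perpEmb_coords w).symm⟩

/-- **Plane rotations are isometries of `ℝ⁴`**: for every linear isometry `R` of `ℝ²` there is a linear isometry `T = R ⊕ id` of
`ℝ⁴ = Π₀ ⊕ Π₀^⊥` with `T (planeEmb y + perpEmb x) = planeEmb (R y) + perpEmb x`. -/
theorem exists_planeRotation (R : E2 ≃ₗᵢ[ℝ] E2) :
    ∃ T : E4 ≃ₗᵢ[ℝ] E4, ∀ y x : E2, T (planeEmb y + perpEmb x) = planeEmb (R y) + perpEmb x := by
  -- coordinate projections onto `Π₀` and `Π₀^⊥`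
  let Pf : E4 → E2 := fun w => (WithLp.equiv 2 (Fin 2 → ℝ)).symm ![w 0, (w 1 + w 2 + w 3) / Real.sqrt 3]
  let Qf : E4 → E2 := fun w => (WithLp.equiv 2 (Fin 2 → ℝ)).symm ![(w 1 - w 2) / Real.sqrt 2, (w 1 + w 2 - 2 * w 3) / Real.sqrt 6]
  have Pf_apply : ∀ w i, Pf w i = ![w 0, (w 1 + w 2 + w 3) / Real.sqrt 3] i := fun w i => rfl
  have Qf_apply : ∀ w i, Qf w i = ![(w 1 - w 2) / Real.sqrt 2, (w 1 + w 2 - 2 * w 3) / Real.sqrt 6] i := fun w i => rfl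
  have Pf_add : ∀ w w', Pf (w + w') = Pf w + Pf w' := fun w w' => by
    ext i; fin_cases i
    · simp [Pf_apply]
    · simp [Pf_apply]; ring
  have Pf_smul : ∀ (c : ℝ) w, Pf (c • w) = c • Pf w := fun c w => by
    ext i; fin_cases i
    · simp [Pf_apply]
    · simp [Pf_apply]; ring
  have Qf_add : ∀ w w', Qf (w + w') = Qf w + Qf w' := fun w w' => by
    ext i; fin_cases i <;> simp [Qf_apply] <;> ring
  have Qf_smul : ∀ (c : ℝ) w, Qf (c • w) = c • Qf w := fun c w => by
    ext i; fin_cases i <;> simp [Qf_apply] <;> ring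
  -- reconstruction and the coordinates of an embedded pair
  have recon : ∀ w, planeEmb (Pf w) + perpEmb (Qf w) = w := fun w => planeEmb_add_perpEmb_coords w
  have Pf_emb : ∀ y x, Pf (planeEmb y + perpEmb x) = y := fun y x => planeCoords_emb y x
  have Qf_emb : ∀ y x, Qf (planeEmb y + perpEmb x) = x := fun y x => perpCoords_emb y x
  -- the linear map `T = R ⊕ id`
  let Tlin : E4 →ₗ[ℝ] E4 :=
    { toFun := fun w => planeEmb (R (Pf w)) + perpEmb (Qf w)
      map_add' := fun w w' => by
        simp only [Pf_add, Qf_add, map_add, planeEmb_add, perpEmb_add]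
        abel
      map_smul' := fun c w => by
        simp only [Pf_smul, Qf_smul, LinearIsometryEquiv.map_smul, planeEmb_smul, perpEmb_smul, RingHom.id_apply, smul_add] }
  have Tlin_apply : ∀ w, Tlin w = planeEmb (R (Pf w)) + perpEmb (Qf w) := fun w => rfl
  -- it preserves the norm
  have hnorm : ∀ w, ‖Tlin w‖ = ‖w‖ := by
    intro w
    have hsq : ‖Tlin w‖ ^ 2 = ‖w‖ ^ 2 := by
      rw [Tlin_apply, norm_sq_planeEmb_add_perpEmb, LinearIsometryEquiv.norm_map]
      conv_rhs => rw [← recon w]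
      rw [norm_sq_planeEmb_add_perpEmb]
    exact (pow_left_inj₀ (norm_nonneg _) (norm_nonneg _) two_ne_zero).1 hsq
  let Tli : E4 →ₗᵢ[ℝ] E4 := ⟨Tlin, hnorm⟩
  refine ⟨Tli.toLinearIsometryEquiv rfl, fun y x => ?_⟩
  show Tlin (planeEmb y + perpEmb x) = planeEmb (R y) + perpEmb x
  rw [Tlin_apply, Pf_emb, Qf_emb]

/-- **`EvenPartSliceInvariant` is a pointwise linear identity among compositions with isometries**: for every isometry `R` of `ℝ²`
there are isometries `T₊, T₋, N` of `ℝ⁴` (`R ⊕ id`, `(−R) ⊕ id`, `(−1) ⊕ id`) such that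
`K (T₊ w) + K (T₋ w) = K w + K (N w)` for all `w`, and conversely these identities at the embedded points ARE the definition. -/
theorem evenPartSliceInvariant_pointwise {K : E4 → ℝ} (hK : EvenPartSliceInvariant K) (R : E2 ≃ₗᵢ[ℝ] E2) :
    ∃ Tp Tm N : E4 ≃ₗᵢ[ℝ] E4,
      (∀ y x : E2, Tp (planeEmb y + perpEmb x) = planeEmb (R y) + perpEmb x) ∧
      (∀ y x : E2, Tm (planeEmb y + perpEmb x) = -planeEmb (R y) + perpEmb x) ∧
      (∀ y x : E2, N (planeEmb y + perpEmb x) = -planeEmb y + perpEmb x) ∧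
      ∀ w : E4, K (Tp w) + K (Tm w) = K w + K (N w) := by
  obtain ⟨Tp, hTp⟩ := exists_planeRotation R
  obtain ⟨Tm, hTm⟩ := exists_planeRotation (R.trans (LinearIsometryEquiv.neg ℝ))
  obtain ⟨N, hN⟩ := exists_planeRotation (LinearIsometryEquiv.neg ℝ : E2 ≃ₗᵢ[ℝ] E2)
  have hTm' : ∀ y x : E2, Tm (planeEmb y + perpEmb x) = -planeEmb (R y) + perpEmb x := fun y x => by
    rw [hTm, LinearIsometryEquiv.trans_apply, LinearIsometryEquiv.coe_neg, planeEmb_neg]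
  have hN' : ∀ y x : E2, N (planeEmb y + perpEmb x) = -planeEmb y + perpEmb x := fun y x => by
    rw [hN, LinearIsometryEquiv.coe_neg, planeEmb_neg]
  refine ⟨Tp, Tm, N, hTp, hTm', hN', fun w => ?_⟩
  obtain ⟨y, x, rfl⟩ := exists_planeEmb_add_perpEmb w
  rw [hTp, hTm', hN']
  exact hK R y x

end Summit.QuantumFields.YangMills.Theorems.F4SubCurvatureDoorAnalyticHalfProof

end
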